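import Summits.QuantumFields.YangMills.Theses.FlatTubeReduction
import Summits.QuantumFields.YangMills.Theorems.FlatTubeReductionValleyRelocalisationNearRegion
import Summits.QuantumFields.YangMills.Theorems.FlatTubeReductionOffTubeSuppression
import Summits.QuantumFields.YangMills.Theorems.FlatTubeReductionTubeMaximiser
import Summits.QuantumFields.YangMills.Theorems.FlatTubeReductionPinnedTubeRatioLawGroundMinMax
import Summits.QuantumFields.YangMills.Theorems.FemtoTransferGapSlabRayleigh
import HarnessLib

/-!
# Route `FlatTubeReduction`: the NEAR-REGION DICHOTOMY GLUE — K1 `NearFlatRatioLaw` from a Born–Oppenheimer ratio law for tube states supported in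
# RED's near region `⋃_z {orbitDist (TT.twist3 z U) < β^{−p}}` ALONE (bears on items 24720 K1, 24921 K1a, 25191 K1b, and on the FixedLatticeLaw pool 23943;
# rung R2b1 = RECORD-label femto gap — no summit statement is proved here)

Seat `ym-line-ftr-p1` g3 (prover).  Companion of `FlatTubeReductionNearFlatDichotomyGlue` (K1 ⇐ K1a with `κ ∈ (14/51,1/3)`): the SAME dichotomy, with the
relocalised state reported in RED's own near-region vocabulary (`ValleyReloc.valleyRelocalisation_nearRegion_at_window`), so that the one remaining
hypothesis is a BO ratio law for tube states `ψ ⊥ Ω` supported in `{U | ∃ z, orbitDist (TT.twist3 z U) < β^{−p}}` — at `p = 1/40` VERBATIM the inner region of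
the FixedLatticeLaw lead's registered stub `stub_boRate` (crux 23943) and of the landed door `innerRateAt_of_bo_pow`.  No Polyakov-pinning geometry
(«pinned ∩ tube ⊂ near region») is then needed on the K1a side.
* ★★ `nearRegionRelocalisation_holds` — the near-region relocalisation, CLOSED (`L ≥ 2`, every `p ∈ (0,1/17)`, every `θ`, every `B ≥ 0`; K2 discharged);
* ★★ `nearFlatRatioLaw_of_nearRegion_dichotomy` — abstract in the admissible set `P` of scales `p`;
* ★★★ `nearFlatRatioLaw_of_nearRegionTubeRatioLaw` — (∀ L ≥ 2, ∃ θ p C β0, 0<θ<1 ∧ 0<p<1/17 ∧ [BO ratio law for `θ`-tube states `⊥ Ω` supported in the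
  `β^{−p}` near region]) → `NearFlatRatioLaw`, everything else discharged (far branch: `oneSiteLevels_proof 1`; `L = 1`: ground min–max).
HONEST FRAMING: fixed-lattice glue; the BO ratio law stays OPEN (FixedLatticeLaw pool); nothing here concerns infinite volume, the continuum limit or the Clay
Yang–Mills mass gap.  No definitions, no named facts, no `sorry`.
References: M. Lüscher, NPB 219 (1983) 233 [cite: Luscher1983, §3]; Lüscher–Münster, NPB 232 (1984) 445 [cite: LuscherMunster1984, §2];
Reed–Simon IV [cite: ReedSimonIV1978, Thm. XIII.1]; B. Simon, Ann. Phys. 146 (1983) 209 [cite: SimonB1983DiscreteSpectrum, §3].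
-/

set_option autoImplicit false

namespace Summit.QuantumFields.YangMills.Theorems.FlatTubeReduction

open Summit.QuantumFields.YangMills.Theses.FlatTubeReduction
open Summit.QuantumFields.YangMills.Theorems.FemtoTransferGap
open Literature.MathematicalPhysics.QuantumFieldTheory (GaugeConfig Site Edge wilsonAction)

/-! ## §1 The near-region relocalisation, closed (`L ≥ 2`, `p ∈ (0, 1/17)`) -/

/-- ★★ **Near-region relocalisation, unconditionally**: for `L ≥ 2`, `θ ∈ (0,1)`, `p ∈ (0, 1/17)` and `B ≥ 0` there are `C ≥ 0`, `β₀` such that for `β ≥ β₀`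
every maximiser `ψ` of the Rayleigh quotient over `θ`-tube physical states `⊥ Ω` WITH `⟨ψ,K_βψ⟩ ≥ (1 − Bλ_b)λ₀‖ψ‖²` admits a `θ`-tube state `ψ' ⊥ Ω` supported in
`{∃ z, orbitDist (TT.twist3 z U) < β^{−p}}`, `‖ψ'‖ ≤ ‖ψ‖`, `⟨ψ,Kψ⟩ ≤ ⟨ψ',Kψ'⟩ + C(λ_b²/L)λ₀‖ψ‖²` (K2 discharged by `offTubeSuppression_proof`).
[cite: Luscher1983, §2–3] [cite: SimonB1983DiscreteSpectrum, §3] -/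
theorem nearRegionRelocalisation_holds (L : ℕ) [NeZero L] (hL : 2 ≤ L) {θ p B : ℝ} (hθ0 : 0 < θ) (hθ1 : θ < 1)
    (hp0 : 0 < p) (hp1 : p < 1 / 17) (hB : 0 ≤ B) :
    ∃ C β0 : ℝ, 0 ≤ C ∧ ∀ β : ℝ, β0 ≤ β → ∀ (Ω ψ : GaugeConfig 3 L SU2 → ℝ), IsPhys Ω → (∀ U, 0 < Ω U) →
      transferApply β Ω = topValue su2Rep L β • Ω → IsPhys ψ → l2 ψ Ω = 0 →
      (∀ U, β ^ (-θ) < wilsonAction su2Rep U → ψ U = 0) →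
      (1 - B * bareLambda β) * topValue su2Rep L β * l2 ψ ψ ≤ qform su2Rep β ψ ψ →
      (∀ φ : GaugeConfig 3 L SU2 → ℝ, IsPhys φ → l2 φ Ω = 0 → (∀ U, β ^ (-θ) < wilsonAction su2Rep U → φ U = 0) →
        qform su2Rep β φ φ * l2 ψ ψ ≤ qform su2Rep β ψ ψ * l2 φ φ) →
      ∃ ψ' : GaugeConfig 3 L SU2 → ℝ, IsPhys ψ' ∧ l2 ψ' Ω = 0 ∧ (∀ U, β ^ (-θ) < wilsonAction su2Rep U → ψ' U = 0) ∧
        (∀ U, ψ' U ≠ 0 → ∃ z : Fin 3 → Bool, orbitDist (TT.twist3 z U) < powScale p β) ∧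
        l2 ψ' ψ' ≤ l2 ψ ψ ∧
        qform su2Rep β ψ ψ ≤ qform su2Rep β ψ' ψ' + C * bareLambda β ^ 2 / L * topValue su2Rep L β * l2 ψ ψ :=
  ValleyReloc.valleyRelocalisation_nearRegion_at_window hL hθ0 hθ1 hp0 hp1 hB (offTubeSuppression_proof L)

/-! ## §2 The dichotomy glue (abstract in the admissible set of near-region scales) -/

set_option maxHeartbeats 1600000 in
open Literature.Analysis.OperatorTheory.YMMatrixModel in
/-- ★★ **Near-region dichotomy glue.**  For any set `P` of admissible scales: the BO ratio law for `θ`-tube states `⊥ Ω` supported in the `β^{−p}` near region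
at SOME `p ∈ P` for every `L ≥ 2`, the near-region relocalisation of near-top tube maximisers at EVERY `p ∈ P`, `θ ∈ (0,1)`, `B ≥ 0` for `L ≥ 2`, and
`TubeMaximiser` imply `NearFlatRatioLaw` — the far branch `ν < (1 − Bλ_b)λ₀` and the lattice `L = 1` being settled by the proved one-site lower law and the
ground-state min–max. [cite: Luscher1983, §3] [cite: ReedSimonIV1978, Thm. XIII.1] -/
theorem nearFlatRatioLaw_of_nearRegion_dichotomy {P : ℝ → Prop}
    (hA : ∀ (L : ℕ) [NeZero L], 2 ≤ L → ∃ θ p C β0 : ℝ, 0 < θ ∧ θ < 1 ∧ P p ∧ ∀ β : ℝ, β0 ≤ β →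
      ∀ (Ω ψ : GaugeConfig 3 L SU2 → ℝ), IsPhys Ω → (∀ U, 0 < Ω U) → transferApply β Ω = topValue su2Rep L β • Ω → IsPhys ψ →
      l2 ψ Ω = 0 → (∀ U, β ^ (-θ) < wilsonAction su2Rep U → ψ U = 0) →
      (∀ U, ψ U ≠ 0 → ∃ z : Fin 3 → Bool, orbitDist (TT.twist3 z U) < powScale p β) →
      qform su2Rep β ψ ψ * levelValue su2Rep 1 ((L : ℝ) ^ 3 * β) 0 ≤
        Real.exp (C * bareLambda β ^ 2 / L) * levelValue su2Rep 1 ((L : ℝ) ^ 3 * β) 1 * topValue su2Rep L β * l2 ψ ψ)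
    (hB : ∀ (L : ℕ) [NeZero L] (θ p B : ℝ), 2 ≤ L → 0 < θ → θ < 1 → P p → 0 ≤ B → ∃ C β0 : ℝ, 0 ≤ C ∧ ∀ β : ℝ, β0 ≤ β →
      ∀ (Ω ψ : GaugeConfig 3 L SU2 → ℝ), IsPhys Ω → (∀ U, 0 < Ω U) → transferApply β Ω = topValue su2Rep L β • Ω → IsPhys ψ →
      l2 ψ Ω = 0 → (∀ U, β ^ (-θ) < wilsonAction su2Rep U → ψ U = 0) →
      (1 - B * bareLambda β) * topValue su2Rep L β * l2 ψ ψ ≤ qform su2Rep β ψ ψ →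
      (∀ φ : GaugeConfig 3 L SU2 → ℝ, IsPhys φ → l2 φ Ω = 0 → (∀ U, β ^ (-θ) < wilsonAction su2Rep U → φ U = 0) →
        qform su2Rep β φ φ * l2 ψ ψ ≤ qform su2Rep β ψ ψ * l2 φ φ) →
      ∃ ψ' : GaugeConfig 3 L SU2 → ℝ, IsPhys ψ' ∧ l2 ψ' Ω = 0 ∧ (∀ U, β ^ (-θ) < wilsonAction su2Rep U → ψ' U = 0) ∧
        (∀ U, ψ' U ≠ 0 → ∃ z : Fin 3 → Bool, orbitDist (TT.twist3 z U) < powScale p β) ∧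
        l2 ψ' ψ' ≤ l2 ψ ψ ∧ qform su2Rep β ψ ψ ≤ qform su2Rep β ψ' ψ' + C * bareLambda β ^ 2 / L * topValue su2Rep L β * l2 ψ ψ)
    (hMax : TubeMaximiser) : NearFlatRatioLaw := by
  intro L _
  by_cases hL : 2 ≤ L
  swap
  · -- `L = 1`: K1 is the ground-state min–max `⟨ψ,K_βψ⟩ ≤ μ₁(β)‖ψ‖²` (`λ₀(β,1) = μ₀(β)`), with `θ = 1/2`, `C = 0`, `β₀ = 1`
    have hL1 : L = 1 := by have := NeZero.ne L; omega
    subst hL1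
    refine ⟨1 / 2, 0, 1, by norm_num, by norm_num, fun β hβ Ω ψ hΩ hΩpos heig hψ horth _ => ?_⟩
    have hβ : 0 < β := by linarith
    have e1 : ((1 : ℕ) : ℝ) ^ 3 * β = β := by norm_num
    rw [e1, zero_mul, zero_div, Real.exp_zero, one_mul, levelValue_zero]
    have h := TubeMax.qform_le_levelValue_one_of_orth_ground (L := 1) hβ hΩ hΩpos heig hψ horth
    have htop : 0 < topValue su2Rep 1 β := topValue_su2Rep_pos 1 β
    calc qform su2Rep β ψ ψ * topValue su2Rep 1 β ≤ (levelValue su2Rep 1 β 1 * l2 ψ ψ) * topValue su2Rep 1 β :=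
          mul_le_mul_of_nonneg_right h htop.le
      _ = levelValue su2Rep 1 β 1 * topValue su2Rep 1 β * l2 ψ ψ := by ring
  -- `L ≥ 2`
  obtain ⟨θ, p, C, β₁, hθ0, hθ1, hPp, H1⟩ := hA L hL
  obtain ⟨C₂, B0, hONE⟩ := oneSiteLevels_proof 1
  set Bc : ℝ := |levelGap 1| + |C₂| with hBc
  have hBc0 : 0 ≤ Bc := by positivity
  obtain ⟨CB, β₂, hCB, H2⟩ := hB L θ p Bc hL hθ0 hθ1 hPp hBc0
  set M : ℝ := Real.exp (|levelGap 1| + |C₂|) with hM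
  refine ⟨θ, |C| + CB * M, max (max β₁ β₂) (max 2 B0), hθ0, hθ1, fun β hβ Ω ψ hΩ hΩpos heig hψ horth hsupp => ?_⟩
  have hβ₁ : β₁ ≤ β := le_trans (le_trans (le_max_left _ _) (le_max_left _ _)) hβ
  have hβ₂ : β₂ ≤ β := le_trans (le_trans (le_max_right _ _) (le_max_left _ _)) hβ
  have h2β : (2 : ℝ) ≤ β := le_trans (le_trans (le_max_left _ _) (le_max_right _ _)) hβ
  have hB0 : B0 ≤ β := le_trans (le_trans (le_max_right _ _) (le_max_right _ _)) hβ
  have hβpos : 0 < β := by linarith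
  have hL1 : (1 : ℝ) ≤ (L : ℝ) := by exact_mod_cast NeZero.one_le
  have hLpos : (0 : ℝ) < (L : ℝ) := by linarith
  have hL3 : (1 : ℝ) ≤ (L : ℝ) ^ 3 := one_le_pow₀ hL1
  have hBge : β ≤ (L : ℝ) ^ 3 * β := le_mul_of_one_le_left hβpos.le hL3
  have hBpos : 0 < (L : ℝ) ^ 3 * β := lt_of_lt_of_le hβpos hBge
  obtain ⟨hμ0pos, -, hlow⟩ := hONE ((L : ℝ) ^ 3 * β) (hB0.trans hBge)
  set μ0 := levelValue su2Rep 1 ((L : ℝ) ^ 3 * β) 0 with hμ0def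
  set μ1 := levelValue su2Rep 1 ((L : ℝ) ^ 3 * β) 1 with hμ1def
  have hμ1nn : 0 ≤ μ1 := levelValue_su2Rep_nonneg 1 hBpos.le 1
  set v := bareLambda β with hvdef
  have hv0 : 0 < v := by
    rw [hvdef, bareLambda]; exact Real.rpow_pos_of_pos (by positivity) _
  have hv1 : v ≤ 1 := by
    rw [hvdef, bareLambda]
    apply Real.rpow_le_one (by positivity) _ (by norm_num)
    rw [div_le_one hβpos]; exact h2β
  have hvB : bareLambda ((L : ℝ) ^ 3 * β) = v / L := bareLambda_cube_mul hβpos L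
  set top := topValue su2Rep L β with htopdef
  have htop : 0 < top := topValue_su2Rep_pos L β
  have hl2ψ : 0 ≤ l2 ψ ψ := l2_self_nonneg ψ
  -- the exponent of the final constant is nonnegative, so `μ₁·top ≤ e^{…}·μ₁·top`
  have hexp1 : 1 ≤ Real.exp ((|C| + CB * M) * bareLambda β ^ 2 / L) := Real.one_le_exp (by positivity)
  -- the proved one-site lower law in the form `(1 − B_c v)·μ₀ ≤ μ₁`
  have hexp_le : levelGap 1 * bareLambda ((L : ℝ) ^ 3 * β) + C₂ * bareLambda ((L : ℝ) ^ 3 * β) ^ 2 ≤ Bc * v := by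
    rw [hvB]
    have hw0 : 0 ≤ v / L := div_nonneg hv0.le hLpos.le
    have hwv : v / L ≤ v := div_le_self hv0.le hL1
    have hw1 : v / L ≤ 1 := hwv.trans hv1
    have e1 : levelGap 1 * (v / L) ≤ |levelGap 1| * v := by
      calc levelGap 1 * (v / L) ≤ |levelGap 1| * (v / L) := mul_le_mul_of_nonneg_right (le_abs_self _) hw0
        _ ≤ |levelGap 1| * v := mul_le_mul_of_nonneg_left hwv (abs_nonneg _)
    have e2 : C₂ * (v / L) ^ 2 ≤ |C₂| * v := by
      have hsq : (v / L) ^ 2 ≤ v := by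
        calc (v / L) ^ 2 = (v / L) * (v / L) := sq _
          _ ≤ 1 * (v / L) := mul_le_mul_of_nonneg_right hw1 hw0
          _ = v / L := one_mul _
          _ ≤ v := hwv
      calc C₂ * (v / L) ^ 2 ≤ |C₂| * (v / L) ^ 2 := mul_le_mul_of_nonneg_right (le_abs_self _) (sq_nonneg _)
        _ ≤ |C₂| * v := mul_le_mul_of_nonneg_left hsq (abs_nonneg _)
    rw [hBc]; linarith
  have hμ0far : (1 - Bc * v) * μ0 ≤ μ1 := by
    have h' : Real.exp (-(Bc * v)) * μ0 ≤ μ1 := by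
      calc Real.exp (-(Bc * v)) * μ0
          ≤ Real.exp (-(levelGap 1 * bareLambda ((L : ℝ) ^ 3 * β) + C₂ * bareLambda ((L : ℝ) ^ 3 * β) ^ 2)) * μ0 :=
            mul_le_mul_of_nonneg_right (Real.exp_le_exp.mpr (neg_le_neg hexp_le)) hμ0pos.le
        _ ≤ μ1 := hlow
    have h1 : 1 - Bc * v ≤ Real.exp (-(Bc * v)) := by
      have := Real.add_one_le_exp (-(Bc * v)); linarith
    exact (mul_le_mul_of_nonneg_right h1 hμ0pos.le).trans h'
  -- the maximiser of the tube problem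
  obtain ⟨ψs, hψs, horths, hsupps, hpos, hmax⟩ := hMax L θ β hθ0 hβpos Ω hΩ
  have hmaxψ := hmax ψ hψ horth hsupp
  by_cases hnear : (1 - Bc * bareLambda β) * topValue su2Rep L β * l2 ψs ψs ≤ qform su2Rep β ψs ψs
  swap
  · -- FAR branch: `⟨ψ⋆,Kψ⋆⟩ < (1 − B_c v)λ₀‖ψ⋆‖²`, hence `⟨ψ,Kψ⟩ ≤ (1 − B_c v)λ₀‖ψ‖²` for the given tube state, and `(1 − B_c v)μ₀ ≤ μ₁`
    have hfar : qform su2Rep β ψs ψs ≤ (1 - Bc * v) * top * l2 ψs ψs := (lt_of_not_ge hnear).le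
    have key : qform su2Rep β ψ ψ ≤ (1 - Bc * v) * top * l2 ψ ψ := by
      have step : qform su2Rep β ψ ψ * l2 ψs ψs ≤ ((1 - Bc * v) * top * l2 ψ ψ) * l2 ψs ψs := by
        calc qform su2Rep β ψ ψ * l2 ψs ψs ≤ qform su2Rep β ψs ψs * l2 ψ ψ := hmaxψ
          _ ≤ ((1 - Bc * v) * top * l2 ψs ψs) * l2 ψ ψ := mul_le_mul_of_nonneg_right hfar hl2ψ
          _ = ((1 - Bc * v) * top * l2 ψ ψ) * l2 ψs ψs := by ring
      exact le_of_mul_le_mul_right step hpos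
    calc qform su2Rep β ψ ψ * μ0 ≤ ((1 - Bc * v) * top * l2 ψ ψ) * μ0 := mul_le_mul_of_nonneg_right key hμ0pos.le
      _ = ((1 - Bc * v) * μ0) * (top * l2 ψ ψ) := by ring
      _ ≤ μ1 * (top * l2 ψ ψ) := mul_le_mul_of_nonneg_right hμ0far (mul_nonneg htop.le hl2ψ)
      _ = 1 * μ1 * top * l2 ψ ψ := by ring
      _ ≤ Real.exp ((|C| + CB * M) * bareLambda β ^ 2 / L) * μ1 * top * l2 ψ ψ := by
          have := mul_le_mul_of_nonneg_right hexp1 (mul_nonneg (mul_nonneg hμ1nn htop.le) hl2ψ)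
          calc 1 * μ1 * top * l2 ψ ψ = 1 * (μ1 * top * l2 ψ ψ) := by ring
            _ ≤ Real.exp ((|C| + CB * M) * bareLambda β ^ 2 / L) * (μ1 * top * l2 ψ ψ) := this
            _ = Real.exp ((|C| + CB * M) * bareLambda β ^ 2 / L) * μ1 * top * l2 ψ ψ := by ring
  -- NEAR-TOP branch: relocalise ψ⋆ into the near region, apply the BO ratio law, transfer by maximality, absorb
  set X : ℝ := Real.exp (C * v ^ 2 / L) * μ1 * top + CB * v ^ 2 / L * top * μ0 with hXdef
  have hE : 0 ≤ Real.exp (C * v ^ 2 / L) * μ1 * top := by positivity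
  have hXnn : 0 ≤ X := by positivity
  obtain ⟨ψ'', hψ'', horth'', hsupp'', hnear'', hle'', hq⟩ :=
    H2 β hβ₂ Ω ψs hΩ hΩpos heig hψs horths hsupps hnear hmax
  have h1 := H1 β hβ₁ Ω ψ'' hΩ hΩpos heig hψ'' horth'' hsupp'' hnear''
  have keys : qform su2Rep β ψs ψs * μ0 ≤ X * l2 ψs ψs := by
    calc qform su2Rep β ψs ψs * μ0
        ≤ (qform su2Rep β ψ'' ψ'' + CB * v ^ 2 / L * top * l2 ψs ψs) * μ0 := mul_le_mul_of_nonneg_right hq hμ0pos.le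
      _ = qform su2Rep β ψ'' ψ'' * μ0 + CB * v ^ 2 / L * top * μ0 * l2 ψs ψs := by ring
      _ ≤ Real.exp (C * v ^ 2 / L) * μ1 * top * l2 ψ'' ψ'' + CB * v ^ 2 / L * top * μ0 * l2 ψs ψs := by linarith [h1]
      _ ≤ Real.exp (C * v ^ 2 / L) * μ1 * top * l2 ψs ψs + CB * v ^ 2 / L * top * μ0 * l2 ψs ψs := by
          linarith [mul_le_mul_of_nonneg_left hle'' hE]
      _ = X * l2 ψs ψs := by rw [hXdef]; ring
  have key : qform su2Rep β ψ ψ * μ0 ≤ X * l2 ψ ψ := by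
    have step : qform su2Rep β ψ ψ * μ0 * l2 ψs ψs ≤ X * l2 ψ ψ * l2 ψs ψs := by
      calc qform su2Rep β ψ ψ * μ0 * l2 ψs ψs = (qform su2Rep β ψ ψ * l2 ψs ψs) * μ0 := by ring
        _ ≤ (qform su2Rep β ψs ψs * l2 ψ ψ) * μ0 := mul_le_mul_of_nonneg_right hmaxψ hμ0pos.le
        _ = (qform su2Rep β ψs ψs * μ0) * l2 ψ ψ := by ring
        _ ≤ (X * l2 ψs ψs) * l2 ψ ψ := mul_le_mul_of_nonneg_right keys hl2ψ
        _ = X * l2 ψ ψ * l2 ψs ψs := by ring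
    exact le_of_mul_le_mul_right step hpos
  refine key.trans ?_
  -- absorption: `X ≤ exp((|C| + C_B·M)v²/L)·μ₁·top`
  have hexp_le' : levelGap 1 * bareLambda ((L : ℝ) ^ 3 * β) + C₂ * bareLambda ((L : ℝ) ^ 3 * β) ^ 2 ≤ |levelGap 1| + |C₂| := by
    calc _ ≤ Bc * v := hexp_le
      _ ≤ Bc * 1 := mul_le_mul_of_nonneg_left hv1 hBc0
      _ = |levelGap 1| + |C₂| := by rw [hBc, mul_one]
  have hμ0M : μ0 ≤ M * μ1 := by
    have h' : μ0 ≤ Real.exp (levelGap 1 * bareLambda ((L : ℝ) ^ 3 * β) + C₂ * bareLambda ((L : ℝ) ^ 3 * β) ^ 2) * μ1 := by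
      have := mul_le_mul_of_nonneg_left hlow
        (Real.exp_pos (levelGap 1 * bareLambda ((L : ℝ) ^ 3 * β) + C₂ * bareLambda ((L : ℝ) ^ 3 * β) ^ 2)).le
      rwa [← mul_assoc, ← Real.exp_add, add_neg_cancel, Real.exp_zero, one_mul] at this
    calc μ0 ≤ _ := h'
      _ ≤ M * μ1 := mul_le_mul_of_nonneg_right (Real.exp_le_exp.mpr hexp_le') hμ1nn
  have hCabs : Real.exp (C * v ^ 2 / L) ≤ Real.exp (|C| * v ^ 2 / L) := by
    rw [Real.exp_le_exp]
    exact div_le_div_of_nonneg_right (mul_le_mul_of_nonneg_right (le_abs_self C) (sq_nonneg v)) hLpos.le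
  have hterm2 : CB * v ^ 2 / L * top * μ0 ≤ (CB * M * v ^ 2 / L) * (μ1 * top) := by
    calc CB * v ^ 2 / L * top * μ0 ≤ CB * v ^ 2 / L * top * (M * μ1) := by
            apply mul_le_mul_of_nonneg_left hμ0M
            positivity
      _ = (CB * M * v ^ 2 / L) * (μ1 * top) := by ring
  have ha : 0 ≤ |C| * v ^ 2 / L := by positivity
  have hb : 0 ≤ CB * M * v ^ 2 / L := by positivity
  have hone : 1 ≤ Real.exp (|C| * v ^ 2 / L) := Real.one_le_exp ha
  have hXle : X ≤ Real.exp ((|C| + CB * M) * bareLambda β ^ 2 / L) * (μ1 * top) := by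
    calc X ≤ Real.exp (|C| * v ^ 2 / L) * (μ1 * top) + (CB * M * v ^ 2 / L) * (μ1 * top) := by
            rw [hXdef]
            have := mul_le_mul_of_nonneg_right hCabs (mul_nonneg hμ1nn htop.le)
            nlinarith [hterm2, this]
      _ = (Real.exp (|C| * v ^ 2 / L) + CB * M * v ^ 2 / L) * (μ1 * top) := by ring
      _ ≤ (Real.exp (|C| * v ^ 2 / L) * Real.exp (CB * M * v ^ 2 / L)) * (μ1 * top) := by
            apply mul_le_mul_of_nonneg_right _ (mul_nonneg hμ1nn htop.le)
            have h1' : CB * M * v ^ 2 / L ≤ Real.exp (|C| * v ^ 2 / L) * (CB * M * v ^ 2 / L) :=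
              le_mul_of_one_le_left hb hone
            have h2' : 1 + CB * M * v ^ 2 / L ≤ Real.exp (CB * M * v ^ 2 / L) := by
              have := Real.add_one_le_exp (CB * M * v ^ 2 / L); linarith
            nlinarith [h1', h2', Real.exp_pos (|C| * v ^ 2 / L)]
      _ = Real.exp ((|C| + CB * M) * bareLambda β ^ 2 / L) * (μ1 * top) := by
            rw [← Real.exp_add]; congr 1; rw [hvdef]; ring
  calc X * l2 ψ ψ ≤ Real.exp ((|C| + CB * M) * bareLambda β ^ 2 / L) * (μ1 * top) * l2 ψ ψ :=
        mul_le_mul_of_nonneg_right hXle hl2ψ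
    _ = Real.exp ((|C| + CB * M) * bareLambda β ^ 2 / L) * μ1 * top * l2 ψ ψ := by ring

/-! ## §3 K1 from the near-region BO ratio law alone -/

/-- ★★★ **`NearFlatRatioLaw` from a Born–Oppenheimer ratio law for tube states supported in RED's near region `{∃ z, orbitDist (TT.twist3 z U) < β^{−p}}`,
`p ∈ (0, 1/17)` (for every `L ≥ 2`) ALONE** — `p = 1/40` is the FixedLatticeLaw lead's inner region verbatim: the near-region relocalisation
(`nearRegionRelocalisation_holds`), `TubeMaximiser` (`tubeMaximiser_proof`), the far branch and `L = 1` are all discharged. [cite: Luscher1983, §3] -/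
theorem nearFlatRatioLaw_of_nearRegionTubeRatioLaw
    (hA : ∀ (L : ℕ) [NeZero L], 2 ≤ L → ∃ θ p C β0 : ℝ, 0 < θ ∧ θ < 1 ∧ (0 < p ∧ p < 1 / 17) ∧ ∀ β : ℝ, β0 ≤ β →
      ∀ (Ω ψ : GaugeConfig 3 L SU2 → ℝ), IsPhys Ω → (∀ U, 0 < Ω U) → transferApply β Ω = topValue su2Rep L β • Ω → IsPhys ψ →
      l2 ψ Ω = 0 → (∀ U, β ^ (-θ) < wilsonAction su2Rep U → ψ U = 0) →
      (∀ U, ψ U ≠ 0 → ∃ z : Fin 3 → Bool, orbitDist (TT.twist3 z U) < powScale p β) →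
      qform su2Rep β ψ ψ * levelValue su2Rep 1 ((L : ℝ) ^ 3 * β) 0 ≤
        Real.exp (C * bareLambda β ^ 2 / L) * levelValue su2Rep 1 ((L : ℝ) ^ 3 * β) 1 * topValue su2Rep L β * l2 ψ ψ) :
    NearFlatRatioLaw :=
  nearFlatRatioLaw_of_nearRegion_dichotomy (P := fun p => 0 < p ∧ p < 1 / 17) hA
    (fun L _ _ _ _ hL hθ0 hθ1 hp hB => nearRegionRelocalisation_holds L hL hθ0 hθ1 hp.1 hp.2 hB) tubeMaximiser_proof

end Summit.QuantumFields.YangMills.Theorems.FlatTubeReduction
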